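import Summits.NavierStokesRegularity.NavierStokesRegularity.Theorems.StrainDoorsSpacetimeRecords
import HarnessLib

/-!
# StrainDoorsVelocityRecord — THE VELOCITY RECORD LAW («the pressure must push the fastest particle»)

nsreg-p1 g35, ROUND-54 PART A (helper lane of `stmt-NavierStokesRegularity-0056`, rung N0; 0 ledger writes by the
planner — text for the S-lane to land `--supports stmt-NavierStokesRegularity-0056 --as helper`).

ROUND-52 priced every new high of the STRAIN number `(T − t)·λ₁` (price: the strain feed `H`), ROUND-53 every new
high of the VORTICITY number `(T − t)·|ω|` (price: stretching minus the viscous twist `ν|∇ξ|²_F`).  This file prices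
every new high of the third scale-invariant one-point number of a putative singularity, the VELOCITY number
`(T − t)^{1/2}·|u|`, and the price is paid by the PRESSURE: at a running record of the velocity number the pressure
gradient along the streamline through the fastest point must be FAVOURABLE and at least `|u|/(2(T − t))`, plus a
viscous credit for the bending of the unit velocity field `û = u/|u|` there.

Classical solution `(u,p)` of the unforced Navier–Stokes equations on a time set `S` of unique differentiability
(`ν ≥ 0`, so Euler is included), an interior time `t` (`S ∈ 𝓝 t`), a point `x`, ANY reference time `T > t`;
`û = vorticityDirection (u t)` (the tree's normalisation `v/|v|`, here applied to the velocity),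
`|∇û|²_F = frobeniusNormSq (fderiv ℝ (vorticityDirection (u t)) x)`, `∇p = gradient (p t) x`.

* §1 `velocityNumber_fermat_left` — one-sided Fermat in time: if `s ↦ (T − s)·|u(s,x)|²` has a LEFT local maximum
  at `t`, then `|u|² ≤ 2(T − t)·⟪u, ∂ₜu⟫` at `(t,x)`.
* §2 `inner_laplacian_le_neg_bend_at_max` — at a spatial maximum `x` of `|v|` with `v(x) ≠ 0`:
  `⟪v, Δv⟫ ≤ −|v|²·|∇(v/|v|)|²_F` (GGH97's magnitude identity (Dw4) read for ANY smooth field, + `Δ|v| ≤ 0`).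
* §3 ★★ `velocity_record_law` — if `x` is a spatial maximum of `|u(t,·)|` and `t` a left local maximum of
  `s ↦ (T − s)|u(s,x)|²` (together: a running space-time record of the velocity number), then
  `|u|²·(1 + 2ν(T − t)|∇û|²_F) ≤ −2(T − t)·⟪u, ∇p⟫` at `(t,x)` (no non-vanishing hypothesis), and, normalised
  (`velocity_record_law_dir`, `u(t,x) ≠ 0`): `|u|·(1 + 2ν(T − t)|∇û|²_F) ≤ 2(T − t)·(−⟪û, ∇p⟫)`:
  **at every running record of the velocity number the pressure DROPS along the streamline through the fastest
  point at rate at least `|u|/(2(T − t))` — the pressure must push the fastest particle.**  (Momentum equation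
  dotted with `u` at the spatial maximum: the transport term `⟪u,(u·∇)u⟫ = ½(u·∇)|u|²` vanishes there, the viscous
  term is `≤ −ν|u|²|∇û|²_F` by §2, and §1.)  Filter form `velocity_running_record_law`.
* §4 ★ `velocity_running_max_law` — the `T = ∞` form: at a running maximum of the speed `|u|` itself,
  `⟪u, ∇p⟫ + ν|u|²|∇û|²_F ≤ 0`: **whenever the maximum speed of the flow is not decreasing, the pressure gradient at
  the fastest point is favourable along the flow** (DNS-checkable; for Euler: `u·∇p ≤ 0` there).

WHAT THIS IS NOT: no blow-up or profile is excluded; `0056`/NS regularity are not proved; a necessary condition AT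
records, constants exactly `1` and `2`, frame-free.  Nearest printed cousins: the one-sided pressure / Bernoulli
regularity criteria of Seregin–Šverák (2002) (global conditions `p ≥ −C` or `|u|²/2 + p ≤ C` imply regularity) and the
maximum principle for the total head pressure in the steady axisymmetric problem (Korobkov–Pileckas–Russo 2015); the
present statement is pointwise, at records, with the parabolic clock `T − t`.  No new definitions; no sorry.
[cite: SereginSverak2002NSLowerBoundsPressure, Thm 1.1; GalantiGibbonHeritage1997, §3 (Dw4) (arXiv:chao-dyn/9709003
p. 7); BealeKatoMajda1984, §1]
-/

noncomputable section

open MeasureTheory Set Function Filter Metric Real InnerProductSpace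
open _root_.Topology
open scoped ENNReal NNReal RealInnerProductSpace ContDiff Laplacian
open Literature.Analysis Literature.Analysis.FluidPDE
open Literature.Analysis.FluidPDE.VorticityDirectionDynamics

set_option linter.dupNamespace false

namespace Summit.NavierStokesRegularity.NavierStokesRegularity.Theorems.StrainDoors

open Summit.NavierStokesRegularity.NavierStokesRegularity.Theorems.ArgmaxDoors

-- nested operator types (second derivatives of the direction field)
set_option maxSynthPendingDepth 3

/-! ## §1 One-sided Fermat in time for the velocity number at a frozen point -/

/-- **One-sided Fermat for the velocity number.**  `u` jointly smooth on `S` (unique differentiability), `S ∈ 𝓝 t`,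
a point `x`.  If `s ↦ (T − s)·|u(s,x)|²` (the squared velocity number at the frozen point `x`; any real `T`) has a LEFT
local maximum at `t`, then `|u(t,x)|² ≤ 2(T − t)·⟪u(t,x), ∂ₜu(t,x)⟫`, `∂ₜu = timeDerivWithin S u t x`
(`F(s) = (T − s)|u(s,x)|²`, `F'(t) = −|u|² + 2(T − t)⟪u,∂ₜu⟫ ≥ 0`). [folklore] -/
theorem velocityNumber_fermat_left {S : Set ℝ}
    {u : ℝ → (EuclideanSpace ℝ (Fin 3)) → (EuclideanSpace ℝ (Fin 3))}
    (h : IsSmoothSpaceTimeOn S u) (hS : UniqueDiffOn ℝ S) {t : ℝ} (T : ℝ) (ht : S ∈ 𝓝 t)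
    (x : EuclideanSpace ℝ (Fin 3))
    (hrec : IsLocalMaxOn (fun s => (T - s) * ‖u s x‖ ^ 2) (Iic t) t) :
    ‖u t x‖ ^ 2 ≤ 2 * (T - t) * ⟪u t x, timeDerivWithin S u t x⟫ := by
  have ht' : t ∈ S := mem_of_mem_nhds ht
  obtain ⟨w, hwdef⟩ : ∃ w, w = timeDerivWithin S u t x := ⟨_, rfl⟩
  have hd : HasDerivAt (fun s => u s x) w t := by
    rw [hwdef]
    exact (h.hasDerivWithinAt_timeDerivWithin hS ht' x).hasDerivAt ht
  have hg : HasDerivAt (fun s => ‖u s x‖ ^ 2) (2 * ⟪u t x, w⟫) t := hd.norm_sq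
  have hl : HasDerivAt (fun s : ℝ => T - s) (-1) t := by
    simpa using (hasDerivAt_id t).const_sub T
  have hF : HasDerivAt (fun s => (T - s) * ‖u s x‖ ^ 2)
      (-1 * ‖u t x‖ ^ 2 + (T - t) * (2 * ⟪u t x, w⟫)) t := hl.mul hg
  have hnn := hasDerivAt_nonneg_of_isLocalMaxOn_Iic hrec hF
  rw [← hwdef]
  linarith

/-! ## §2 The magnitude identity at a spatial maximum of an arbitrary smooth field -/

/-- **Diffusion at a spatial maximum, with the bending credit.**  For a smooth field `v` on `ℝ³` and a global
maximum point `x₀` of `|v|` with `v(x₀) ≠ 0`: `⟪v(x₀), Δv(x₀)⟫ ≤ −|v(x₀)|²·|∇(v/|v|)(x₀)|²_F`.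
(GGH97 (Dw4) for any field: `Δ|v| = ⟪v/|v|, Δv⟫ + |v|·|∇(v/|v|)|²_F` where `v ≠ 0`, and `Δ|v|(x₀) ≤ 0` at the
maximum.)  The vorticity instance is inside `ArgmaxDoors.inner_vorticity_rhs_le_at_argmax`. [cite: GalantiGibbonHeritage1997, §3 (Dw4) (arXiv:chao-dyn/9709003 p. 7)] -/
theorem inner_laplacian_le_neg_bend_at_max
    {v : (EuclideanSpace ℝ (Fin 3)) → (EuclideanSpace ℝ (Fin 3))} (hv : ContDiff ℝ ∞ v)
    {x₀ : EuclideanSpace ℝ (Fin 3)} (hmax : ∀ x, ‖v x‖ ≤ ‖v x₀‖) (hne : v x₀ ≠ 0) :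
    ⟪v x₀, (Δ v) x₀⟫ ≤ -(‖v x₀‖ ^ 2 * frobeniusNormSq (fderiv ℝ (vorticityDirection v) x₀)) := by
  have hvC2 : ContDiff ℝ 2 v := contDiff_infty.mp hv 2
  have hv2 : ContDiffAt ℝ 2 v x₀ := hvC2.contDiffAt
  set ρ : ℝ := ‖v x₀‖ with hρdef
  have hρ : 0 < ρ := norm_pos_iff.2 hne
  have hlapnorm : (Δ fun y => ‖v y‖) x₀ ≤ 0 := by
    have hopen : IsOpen {y : EuclideanSpace ℝ (Fin 3) | v y ≠ 0} :=
      isOpen_ne_fun hv.continuous continuous_const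
    have hC2 : ContDiffOn ℝ 2 (fun y => ‖v y‖) {y | v y ≠ 0} := fun y hy =>
      ((hvC2.contDiffAt).norm ℝ hy).contDiffWithinAt
    have hloc : IsLocalMax (fun y => ‖v y‖) x₀ := Filter.Eventually.of_forall hmax
    exact laplacian_nonpos_of_isLocalMax_of_contDiffOn hopen hne hC2 hloc
  have h1 : v x₀ = ρ • vorticityDirection v x₀ := by rw [hρdef, norm_smul_vorticityDirection]
  have h2 : ⟪vorticityDirection v x₀, (Δ v) x₀⟫ = (Δ fun y => ‖v y‖) x₀ -
      ρ * frobeniusNormSq (fderiv ℝ (vorticityDirection v) x₀) := by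
    have h := laplacian_norm_eq hv2 hne
    rw [hρdef]; linarith
  rw [h1, inner_smul_left]
  simp only [conj_trivial]
  rw [h2]
  have hF : 0 ≤ frobeniusNormSq (fderiv ℝ (vorticityDirection v) x₀) := frobeniusNormSq_nonneg _
  nlinarith [hlapnorm, hρ, hF]

/-! ## §3 The velocity record law -/

/-- ★★ **THE VELOCITY RECORD LAW.**  Classical unforced solution on `S` (unique differentiability, `ν ≥ 0`),
interior time `t < T`, a point `x` which is (i) a spatial maximum of `|u(t,·)|` and (ii) a LEFT local maximum in
time of `s ↦ (T − s)|u(s,x)|²` (together: a running space-time record of the velocity number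
`(T − s)^{1/2}‖u(s)‖_∞`).  Then, with `û = u/|u|` and `∇p = gradient (p t) x`,
`|u(t,x)|²·(1 + 2ν(T − t)|∇û(t,x)|²_F) ≤ −2(T − t)·⟪u(t,x), ∇p(t,x)⟫`.
Proof: §1 gives `|u|² ≤ 2(T − t)⟪u, ∂ₜu⟫`; the momentum equation gives
`⟪u,∂ₜu⟫ = ν⟪u,Δu⟫ − ⟪u,∇p⟫ − ⟪u,(u·∇)u⟫`, where the transport term vanishes at the spatial maximum of `|u|²`
(`inner_fderiv_eq_zero_of_forall_norm_sq_le`) and `⟪u,Δu⟫ ≤ −|u|²|∇û|²_F` (§2).  If `u(t,x) = 0` both sides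
vanish. [folklore] -/
theorem velocity_record_law {ν T : ℝ} {S : Set ℝ}
    {u : ℝ → (EuclideanSpace ℝ (Fin 3)) → (EuclideanSpace ℝ (Fin 3))} {p : ℝ → (EuclideanSpace ℝ (Fin 3)) → ℝ}
    (hν : 0 ≤ ν) (hS : UniqueDiffOn ℝ S) (hsol : IsClassicalNSSolutionOn S ν 0 u p)
    {t : ℝ} (ht : S ∈ 𝓝 t) (htT : t < T) {x : EuclideanSpace ℝ (Fin 3)}
    (hmaxX : ∀ y, ‖u t y‖ ≤ ‖u t x‖)
    (hmaxT : IsLocalMaxOn (fun s => (T - s) * ‖u s x‖ ^ 2) (Iic t) t) :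
    ‖u t x‖ ^ 2 * (1 + 2 * ν * (T - t) * frobeniusNormSq (fderiv ℝ (vorticityDirection (u t)) x)) ≤
      -(2 * (T - t) * ⟪u t x, gradient (p t) x⟫) := by
  have ht' : t ∈ S := mem_of_mem_nhds ht
  have hTt : 0 < T - t := sub_pos.mpr htT
  have hv : ContDiff ℝ ∞ (u t) := hsol.contDiff_velocity ht'
  by_cases hne : u t x = 0
  · rw [hne]; simp
  -- Fermat in time
  have h1 := velocityNumber_fermat_left hsol.smooth_velocity hS T ht x hmaxT
  -- the momentum equation at `(t,x)`, dotted with `u`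
  have hm := hsol.momentum t ht' x
  have hw : timeDerivWithin S u t x =
      ν • (Δ (u t)) x - gradient (p t) x - convect (u t) (u t) x := by
    rw [eq_sub_iff_add_eq, hm]; simp
  have hmax2 : ∀ y, ‖u t y‖ ^ 2 ≤ ‖u t x‖ ^ 2 := fun y =>
    pow_le_pow_left₀ (norm_nonneg _) (hmaxX y) 2
  have htr : ⟪u t x, convect (u t) (u t) x⟫ = 0 := by
    rw [convect_apply]
    exact inner_fderiv_eq_zero_of_forall_norm_sq_le hv hmax2 _
  have hdiff := inner_laplacian_le_neg_bend_at_max hv hmaxX hne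
  have hin : ⟪u t x, timeDerivWithin S u t x⟫ =
      ν * ⟪u t x, (Δ (u t)) x⟫ - ⟪u t x, gradient (p t) x⟫ := by
    rw [hw, inner_sub_right, inner_sub_right, inner_smul_right, htr, sub_zero]
  rw [hin] at h1
  obtain ⟨L, hL⟩ : ∃ L : ℝ, L = ⟪u t x, (Δ (u t)) x⟫ := ⟨_, rfl⟩
  obtain ⟨F, hF⟩ : ∃ F : ℝ, F = frobeniusNormSq (fderiv ℝ (vorticityDirection (u t)) x) := ⟨_, rfl⟩
  obtain ⟨P, hP⟩ : ∃ P : ℝ, P = ⟪u t x, gradient (p t) x⟫ := ⟨_, rfl⟩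
  rw [← hL, ← hP] at h1
  rw [← hL, ← hF] at hdiff
  rw [← hF, ← hP]
  have hc : 2 * (T - t) * ν * L ≤ 2 * (T - t) * ν * (-(‖u t x‖ ^ 2 * F)) :=
    mul_le_mul_of_nonneg_left hdiff (by positivity)
  nlinarith [h1, hc]

/-- ★★ **The velocity record law, normalised.**  Under the hypotheses of `velocity_record_law` and `u(t,x) ≠ 0`:
`|u(t,x)|·(1 + 2ν(T − t)|∇û|²_F) ≤ 2(T − t)·(−⟪û(t,x), ∇p(t,x)⟫)` — the pressure drops along the streamline
through the fastest point at rate at least `|u|/(2(T − t))`. [folklore] -/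
theorem velocity_record_law_dir {ν T : ℝ} {S : Set ℝ}
    {u : ℝ → (EuclideanSpace ℝ (Fin 3)) → (EuclideanSpace ℝ (Fin 3))} {p : ℝ → (EuclideanSpace ℝ (Fin 3)) → ℝ}
    (hν : 0 ≤ ν) (hS : UniqueDiffOn ℝ S) (hsol : IsClassicalNSSolutionOn S ν 0 u p)
    {t : ℝ} (ht : S ∈ 𝓝 t) (htT : t < T) {x : EuclideanSpace ℝ (Fin 3)}
    (hmaxX : ∀ y, ‖u t y‖ ≤ ‖u t x‖)
    (hmaxT : IsLocalMaxOn (fun s => (T - s) * ‖u s x‖ ^ 2) (Iic t) t) (hne : u t x ≠ 0) :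
    ‖u t x‖ * (1 + 2 * ν * (T - t) * frobeniusNormSq (fderiv ℝ (vorticityDirection (u t)) x)) ≤
      2 * (T - t) * (-⟪vorticityDirection (u t) x, gradient (p t) x⟫) := by
  have h := velocity_record_law hν hS hsol ht htT hmaxX hmaxT
  have hρ : 0 < ‖u t x‖ := norm_pos_iff.mpr hne
  have hdir : ⟪vorticityDirection (u t) x, gradient (p t) x⟫ = ‖u t x‖⁻¹ * ⟪u t x, gradient (p t) x⟫ := by
    rw [show vorticityDirection (u t) x = ‖u t x‖⁻¹ • u t x from rfl, inner_smul_left]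
    simp
  rw [hdir]
  obtain ⟨F, hF⟩ : ∃ F : ℝ, F = frobeniusNormSq (fderiv ℝ (vorticityDirection (u t)) x) := ⟨_, rfl⟩
  obtain ⟨P, hP⟩ : ∃ P : ℝ, P = ⟪u t x, gradient (p t) x⟫ := ⟨_, rfl⟩
  rw [← hF, ← hP] at h ⊢
  have key : ‖u t x‖ * (‖u t x‖ * (1 + 2 * ν * (T - t) * F)) ≤ ‖u t x‖ * (2 * (T - t) * (-(‖u t x‖⁻¹ * P))) := by
    have e1 : ‖u t x‖ * (2 * (T - t) * (-(‖u t x‖⁻¹ * P))) = -(2 * (T - t) * P) := by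
      field_simp
    rw [e1]; nlinarith [h]
  exact le_of_mul_le_mul_left key hρ

/-- ★★ **Filter form (a running record of the velocity number).**  If the squared velocity number at `(t,x)`
DOMINATES ITS RECENT PAST — `(T − s)|u(s,y)|² ≤ (T − t)|u(t,x)|²` for all `y` and all `s ≤ t` near `t` — then the
velocity record law holds at `(t,x)`. [folklore] -/
theorem velocity_running_record_law {ν T : ℝ} {S : Set ℝ}
    {u : ℝ → (EuclideanSpace ℝ (Fin 3)) → (EuclideanSpace ℝ (Fin 3))} {p : ℝ → (EuclideanSpace ℝ (Fin 3)) → ℝ}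
    (hν : 0 ≤ ν) (hS : UniqueDiffOn ℝ S) (hsol : IsClassicalNSSolutionOn S ν 0 u p)
    {t : ℝ} (ht : S ∈ 𝓝 t) (htT : t < T) {x : EuclideanSpace ℝ (Fin 3)}
    (hrec : ∀ᶠ s in 𝓝[≤] t, ∀ y, (T - s) * ‖u s y‖ ^ 2 ≤ (T - t) * ‖u t x‖ ^ 2) :
    ‖u t x‖ ^ 2 * (1 + 2 * ν * (T - t) * frobeniusNormSq (fderiv ℝ (vorticityDirection (u t)) x)) ≤
      -(2 * (T - t) * ⟪u t x, gradient (p t) x⟫) := by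
  have hTt : 0 < T - t := sub_pos.mpr htT
  have hnow := hrec.self_of_nhdsWithin (mem_Iic.mpr le_rfl)
  have hmaxX : ∀ y, ‖u t y‖ ≤ ‖u t x‖ := fun y => by
    have h2 : ‖u t y‖ ^ 2 ≤ ‖u t x‖ ^ 2 := le_of_mul_le_mul_left (hnow y) hTt
    exact (pow_le_pow_iff_left₀ (norm_nonneg _) (norm_nonneg _) two_ne_zero).mp h2
  have hmaxT : IsLocalMaxOn (fun s => (T - s) * ‖u s x‖ ^ 2) (Iic t) t := by
    show ∀ᶠ s in 𝓝[Iic t] t, (T - s) * ‖u s x‖ ^ 2 ≤ (T - t) * ‖u t x‖ ^ 2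
    filter_upwards [hrec] with s hs using hs x
  exact velocity_record_law hν hS hsol ht htT hmaxX hmaxT

/-! ## §4 The `T = ∞` form: running maxima of the speed -/

/-- ★ **THE SPEED RUNNING-MAX LAW.**  Classical unforced solution on `S` (`ν ≥ 0`), interior time `t`, a point `x`
at which the speed DOMINATES ITS RECENT PAST EVERYWHERE — `|u(s,y)| ≤ |u(t,x)|` for all `y`, all `s ≤ t` near `t`
(a new high of `‖u‖_∞`).  Then `⟪u(t,x), ∇p(t,x)⟫ + ν|u(t,x)|²|∇û(t,x)|²_F ≤ 0`: the pressure gradient at the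
fastest point is favourable along the flow (for Euler: `u·∇p ≤ 0` there). [folklore] -/
theorem velocity_running_max_law {ν : ℝ} {S : Set ℝ}
    {u : ℝ → (EuclideanSpace ℝ (Fin 3)) → (EuclideanSpace ℝ (Fin 3))} {p : ℝ → (EuclideanSpace ℝ (Fin 3)) → ℝ}
    (hν : 0 ≤ ν) (hS : UniqueDiffOn ℝ S) (hsol : IsClassicalNSSolutionOn S ν 0 u p)
    {t : ℝ} (ht : S ∈ 𝓝 t) {x : EuclideanSpace ℝ (Fin 3)}
    (hrec : ∀ᶠ s in 𝓝[≤] t, ∀ y, ‖u s y‖ ≤ ‖u t x‖) :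
    ⟪u t x, gradient (p t) x⟫ + ν * (‖u t x‖ ^ 2 * frobeniusNormSq (fderiv ℝ (vorticityDirection (u t)) x)) ≤
      0 := by
  have ht' : t ∈ S := mem_of_mem_nhds ht
  have hv : ContDiff ℝ ∞ (u t) := hsol.contDiff_velocity ht'
  have hmaxX : ∀ y, ‖u t y‖ ≤ ‖u t x‖ := (hrec.self_of_nhdsWithin (mem_Iic.mpr le_rfl))
  by_cases hne : u t x = 0
  · rw [hne]; simp
  -- Fermat in time for `s ↦ |u(s,x)|²`
  obtain ⟨w, hwdef⟩ : ∃ w, w = timeDerivWithin S u t x := ⟨_, rfl⟩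
  have hd : HasDerivAt (fun s => u s x) w t := by
    rw [hwdef]
    exact (hsol.smooth_velocity.hasDerivWithinAt_timeDerivWithin hS ht' x).hasDerivAt ht
  have hg : HasDerivAt (fun s => ‖u s x‖ ^ 2) (2 * ⟪u t x, w⟫) t := hd.norm_sq
  have hrecG : IsLocalMaxOn (fun s => ‖u s x‖ ^ 2) (Iic t) t := by
    show ∀ᶠ s in 𝓝[Iic t] t, ‖u s x‖ ^ 2 ≤ ‖u t x‖ ^ 2
    filter_upwards [hrec] with s hs using pow_le_pow_left₀ (norm_nonneg _) (hs x) 2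
  have hnn := hasDerivAt_nonneg_of_isLocalMaxOn_Iic hrecG hg
  -- momentum dotted with `u`
  have hm := hsol.momentum t ht' x
  have hw : timeDerivWithin S u t x =
      ν • (Δ (u t)) x - gradient (p t) x - convect (u t) (u t) x := by
    rw [eq_sub_iff_add_eq, hm]; simp
  have hmax2 : ∀ y, ‖u t y‖ ^ 2 ≤ ‖u t x‖ ^ 2 := fun y =>
    pow_le_pow_left₀ (norm_nonneg _) (hmaxX y) 2
  have htr : ⟪u t x, convect (u t) (u t) x⟫ = 0 := by
    rw [convect_apply]
    exact inner_fderiv_eq_zero_of_forall_norm_sq_le hv hmax2 _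
  have hdiff := inner_laplacian_le_neg_bend_at_max hv hmaxX hne
  have hin : ⟪u t x, w⟫ = ν * ⟪u t x, (Δ (u t)) x⟫ - ⟪u t x, gradient (p t) x⟫ := by
    rw [hwdef, hw, inner_sub_right, inner_sub_right, inner_smul_right, htr, sub_zero]
  rw [hin] at hnn
  have hc := mul_le_mul_of_nonneg_left hdiff hν
  linarith

end Summit.NavierStokesRegularity.NavierStokesRegularity.Theorems.StrainDoors

end
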